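import Summits.QuantumFields.YangMills.Theorems.SwapVirialDeficitSectorLaplaceChartMeasure
import Summits.QuantumFields.YangMills.Theorems.SwapVirialDeficitBlowUpGnomonicRingChartTranslatedReal
import Summits.QuantumFields.YangMills.Theorems.SwapVirialDeficitConeMeasureHubCot
import HarnessLib

/-!
# SECTOR `z` IN THE TRANSLATED CHART MEASURE and the `(TS)_z` socket from per-sign-pattern chart stiffness (sector-001 assembly of LEAD sfw-p2 g98's
# memo7 plan of record for ⟨stmt-QuantumFields-24197⟩ `SwapVirialDeficit.SwapGluedStiffness`, §E(5) "001 = ONE translated chart, one region, plain κ")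

The twins, for an ARBITRARY sector `z` and an arbitrary unit `u` (sector `001`: `z = z₁`, `u = qJ`), of the sector-`000` identities of ✓`…SectorLaplaceChartMeasure` §2–§3:
the ring expectations of functions of `F^S_z` are `K_L·Σ_ε ∫ (…)(F̂ᵘ_{z,ε}) d(chartMeasure L)` with the translated deficit ✓`trGnoDeficit u z 1` (✓`integral_ringMeasure_eq_trGnomonic`,
`chartMeasure L = cone ⊗ ρdη` ✓`SectorLaplaceDefs` §6, SAME constant `K_L` ✓`KL` and SAME density as sector `000`).
* §1 `exists_abs_trGnoDeficit_le` (a uniform bound, ✓`exists_abs_swapRingDeficit_le`); ★ `trGnoDeficit_eq_hubCot` (the hub enters only through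
  `δ = re a ∕ ‖Im a‖`: `F̂ᵘ_{z,a,ε} = F̂ᵘ_{z, hubAt δ 1, ε}`, twin of ✓`gnoDeficit_eq_hubCot` — so ✓`lintegral_chartMeasure_hubCot` applies to the 001 regions verbatim),
  `measurable_trBDeficit` (`(δ, η) ↦ F̂ᵘ_{z, hubAt δ 1, ε}(η)` is measurable);
* §2 ★★ `sector_integral_eq_trChartMeasure` (`∫ g(F^S_z) dμ_L = K_L·Σ_ε ∫ g(F̂ᵘ_{z,ε}) d(chartMeasure)` for measurable `g` bounded along the deficit),
  ★ `sector_exp_eq_trChartMeasure` (`Z_z(b)`), ★ `sector_action_eq_trChartMeasure` (`E_z(b)`);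
* §3 ★★★ `sectorStiffness_of_trChartStiffness` — `(TS)_z` at fixed `L`, `b > 0`: per-sign-pattern chart stiffness `κ·∫e^{−bF̂ᵘ_ε} ≤ b·∫F̂ᵘ_ε e^{−bF̂ᵘ_ε}` on the
  patterns of an arbitrary class `Good`, a pointwise floor `κ ≤ b·F̂ᵘ_{a,ε}(η)` at every hub with `a.re ≠ 0`, `a.im ≠ 0` on the others ⟹ `κ·Z_z(b) ≤ b·E_z(b)`;
* §4 ★★ `h001_of_trChart_stubs` — the uniform form: polynomial thresholds in, LITERALLY the statement of the skeleton stub `stub_h001_window`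
  (`κ = 9L⁴ − 3/2 + 1/8`, sector `z₁`, any fixed unit `u`) out — the socket into ✓`twoSectorStiffness_of_windows` (h1).
* §5 (appended) THE SECTOR CHARACTER: the same for an ARBITRARY CENTRAL seam character `χ` (the sector-`z` chart must use `χ_z = sectorChar z` of ✓Defs §9 —
  with `χ ≡ 1` the twist of a sector `z ≠ 000` sits at the seam followers' gnomonic infinity): `sector_integral∕exp∕action_eq_trChartMeasure_chi`,
  ★★★ `sectorStiffness_of_trChartStiffness_chi`, ★★ `h001_of_trChart_stubs_chi (hu) (χ : ∀ L, Site 3 L → SU2) (hχ : central) (Good) (hgood) (hbad)` (output again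
  LITERALLY `stub_h001_window`; the skeleton takes `χ L := sectorChar z₁`).
HONEST LABEL: identities and bookkeeping at fixed `L` plus the uniform wrapper; the two 001 stubs (good-pattern chart stiffness in the translated chart, bad-pattern
floor) are OPEN (w3 ∕ w2); nothing about ⟨24197⟩, ⟨24194⟩ or any rung is proved here; the Yang–Mills mass gap is NOT proved; no summit is proved by a line.
Seat ym-line-fcl-p3 g47 (cell ym-idea-1, free hands ➎ assembler; item of record ⟨24085⟩ aside, untouched), `--supports stmt-QuantumFields-24197`.
THEOREMS ONLY (0 `def`, 0 `sorry`), standard axioms.  References: [cite: tHooft1979]; [cite: Luscher1983, §2]; [folklore].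
-/

set_option autoImplicit false
set_option synthInstance.maxSize 1024

noncomputable section

open MeasureTheory Quaternion Set
open scoped Quaternion BigOperators ENNReal
open Literature.MathematicalPhysics.QuantumLattice
open Literature.MathematicalPhysics.QuantumFieldTheory hiding SU2
open Summit.QuantumFields.YangMills.Theorems.SwapTwistDeficit.ToronLog

attribute [local instance] Literature.Analysis.FluidPDE.Tao2016.quatMeasurableSpace
  Literature.Analysis.FluidPDE.Tao2016.quatBorelSpace
  Literature.MathematicalPhysics.QuantumLattice.secondCountableTopology_su2

namespace Summit.QuantumFields.YangMills.Theorems.SwapVirialDeficit.SectorLaplace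

open Summit.QuantumFields.YangMills.Theorems.FemtoTransferGap
open Summit.QuantumFields.YangMills.Theorems.FemtoTransferGap.TT
open Summit.QuantumFields.YangMills.Theorems.VirialFluxGap.RingDeficit
open Summit.QuantumFields.YangMills.Theorems.SwapVirialDeficit.SwapRing
open Summit.QuantumFields.YangMills.Theorems.SwapVirialDeficit.BlowUpRing

variable {L : ℕ} [NeZero L]

/-! ## §1 A uniform bound on the translated deficit -/

/-- `|F̂ᵘ_{z,a,ε}(η)| ≤ B` uniformly (the ring deficit is bounded, ✓`exists_abs_swapRingDeficit_le`). [folklore] -/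
theorem exists_abs_trGnoDeficit_le (u : ℍ) (z : Fin 3 → Bool) (χ : Site 3 L → SU2) :
    ∃ B : ℝ, 0 ≤ B ∧ ∀ (a : ℍ) (ε : GnoSign L) (η : GnoCoord L), |trGnoDeficit u z χ a ε η| ≤ B := by
  obtain ⟨B, hB⟩ := exists_abs_swapRingDeficit_le (L := L) z
  refine ⟨B, ?_, fun a ε η => hB _⟩
  obtain ⟨a⟩ : Nonempty ℍ := ⟨0⟩
  exact (abs_nonneg _).trans (hB (fixHistory (ringConfig χ (blowUpPoint 1 (trGnomonicPoint u a (Classical.arbitrary _) (Classical.arbitrary _))))))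

/-- ★ **THE TRANSLATED DEFICIT DEPENDS ON THE HUB ONLY THROUGH `δ = cot ψ = re a ∕ ‖Im a‖`**: `F̂ᵘ_{z,a,ε}(η) = F̂ᵘ_{z, hubAt δ 1, ε}(η)` (`Im a ≠ 0`;
twin of ✓`gnoDeficit_eq_hubCot`). [folklore] -/
theorem trGnoDeficit_eq_hubCot (u : ℍ) (z : Fin 3 → Bool) (χ : Site 3 L → SU2) {a : ℍ} (him : a.im ≠ 0) (ε : GnoSign L) (η : GnoCoord L) :
    trGnoDeficit u z χ a ε η = trGnoDeficit u z χ (hubAt (a.re / ‖a.im‖) 1) ε η := by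
  unfold trGnoDeficit blowUpPoint trGnomonicPoint
  simp only [BlowUp.leaderTuple, radialUnit_axisPoint_hubCot him]

/-- `(δ, η) ↦ F̂ᵘ_{z, hubAt δ 1, ε}(η)` is measurable on `ℝ × GnoCoord L` (the integrand of the 001 regions in the hub letter). [folklore] -/
theorem measurable_trBDeficit (u : ℍ) (z : Fin 3 → Bool) (χ : Site 3 L → SU2) (ε : GnoSign L) :
    Measurable fun p : ℝ × GnoCoord L => trGnoDeficit u z χ (hubAt p.1 1) ε p.2 := by
  have h1 : Measurable fun p : ℝ × GnoCoord L => hubAt p.1 1 := by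
    have e : (fun p : ℝ × GnoCoord L => hubAt p.1 1) = (fun q : ℝ × ℝ => hubAt q.1 q.2) ∘ fun p : ℝ × GnoCoord L => (p.1, (1 : ℝ)) := rfl
    rw [e]
    exact measurable_hubAt.comp (measurable_fst.prodMk measurable_const)
  have e : (fun p : ℝ × GnoCoord L => trGnoDeficit u z χ (hubAt p.1 1) ε p.2) =
      (fun q : ℍ × GnoCoord L => trGnoDeficit u z χ q.1 ε q.2) ∘ fun p : ℝ × GnoCoord L => (hubAt p.1 1, p.2) := rfl
  rw [e]
  exact (measurable_trGnoDeficit_uncurry u z χ ε).comp (h1.prodMk measurable_snd)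

/-! ## §2 Ring expectations of functions of `F^S_z` in the translated chart measure -/

set_option maxHeartbeats 400000 in
/-- ★★ **THE RING INTEGRAL IN THE TRANSLATED CHART MEASURE**: for a unit `u`, a sector `z` and measurable `g` bounded along the deficit,
`∫ g(F^S_z(P)) dμ_L(P) = K_L·Σ_ε ∫ g(F̂ᵘ_{z,a,ε}(η)) d(chartMeasure)(a,η)` (✓`integral_ringMeasure_eq_trGnomonic` with the seam-invariant integrand `g ∘ F^S_z`,
then Fubini per sign pattern). [cite: tHooft1979] -/
theorem sector_integral_eq_trChartMeasure {u : ℍ} (hu : ‖u‖ = 1) (z : Fin 3 → Bool) {g : ℝ → ℝ} (hg : Measurable g) {M : ℝ}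
    (hbd : ∀ P : (Fin (2 * L - 1 + 1) → GaugeConfig 3 L SU2) × (Site 3 L → SU2), |g (swapRingDeficit L z P)| ≤ M) :
    ∫ P, g (swapRingDeficit L z P) ∂(ringMeasure L) =
      KL L * ∑ ε : GnoSign L, ∫ x, g (trGnoDeficit u z (fun _ => 1) x.1 ε x.2) ∂chartMeasure L := by
  have h := integral_ringMeasure_eq_trGnomonic (L := L) hu (⇑(sitePerm (L := L) (Equiv.swap (0 : Fin 3) 1))) (χ := fun _ => 1) one_central
    (G := fun p => g (swapRingDeficit L z p)) (hg.comp (measurable_swapRingDeficit z)) (M := M) (fun p => hbd p)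
    (fun h p => by simp only [swapRingDeficit_seamGaugeAct])
  rw [h]
  show KL L * ∫ a, (∑ ε : GnoSign L, ∫ η : GnoCoord L, g (trGnoDeficit u z (fun _ => 1) a ε η) * gnoDensity η) ∂coneMeasure = _
  have hbd' : ∀ (ε : GnoSign L) (x : ℍ × GnoCoord L), |g (trGnoDeficit u z (fun _ => 1) x.1 ε x.2)| ≤ M := fun ε x => hbd _
  have hmeas : ∀ ε : GnoSign L, Measurable fun x : ℍ × GnoCoord L => g (trGnoDeficit u z (fun _ => 1) x.1 ε x.2) :=
    fun ε => hg.comp (measurable_trGnoDeficit_uncurry u z (fun _ => 1) ε)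
  have hint : ∀ ε : GnoSign L, Integrable (fun a : ℍ => ∫ η : GnoCoord L, g (trGnoDeficit u z (fun _ => 1) a ε η) * gnoDensity η) coneMeasure :=
    fun ε => integrable_fibreIntegral_of_bounded (hmeas ε) (hbd' ε)
  rw [integral_finsetSum _ fun ε _ => hint ε]
  refine congrArg (fun t => KL L * t) (Finset.sum_congr rfl fun ε _ => ?_)
  exact (integral_chartMeasure (integrable_chartMeasure_of_bounded (hmeas ε) (hbd' ε))).symm

/-- ★ `Z_z(b) = K_L·Σ_ε ∫ e^{−bF̂ᵘ_ε} d(chartMeasure)` (`b ≥ 0`). [cite: tHooft1979] -/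
theorem sector_exp_eq_trChartMeasure {u : ℍ} (hu : ‖u‖ = 1) (z : Fin 3 → Bool) {b : ℝ} (hb : 0 ≤ b) :
    ∫ P, Real.exp (-(b * swapRingDeficit L z P)) ∂(ringMeasure L) =
      KL L * ∑ ε : GnoSign L, ∫ x, Real.exp (-(b * trGnoDeficit u z (fun _ => 1) x.1 ε x.2)) ∂chartMeasure L :=
  sector_integral_eq_trChartMeasure hu z (g := fun t => Real.exp (-(b * t))) (Real.measurable_exp.comp ((measurable_id.const_mul b).neg)) (M := 1)
    fun P => by
      rw [abs_of_pos (Real.exp_pos _)]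
      exact Real.exp_le_one_iff.2 (by have := swapRingDeficit_nonneg (L := L) z P; nlinarith)

/-- ★ `E_z(b) = ∫F e^{−bF} dμ_L = K_L·Σ_ε ∫ F̂ᵘ_ε e^{−bF̂ᵘ_ε} d(chartMeasure)` (`b ≥ 0`). [cite: tHooft1979] -/
theorem sector_action_eq_trChartMeasure {u : ℍ} (hu : ‖u‖ = 1) (z : Fin 3 → Bool) {b : ℝ} (hb : 0 ≤ b) :
    ∫ P, swapRingDeficit L z P * Real.exp (-(b * swapRingDeficit L z P)) ∂(ringMeasure L) =
      KL L * ∑ ε : GnoSign L, ∫ x, trGnoDeficit u z (fun _ => 1) x.1 ε x.2 * Real.exp (-(b * trGnoDeficit u z (fun _ => 1) x.1 ε x.2)) ∂chartMeasure L := by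
  obtain ⟨B, hB⟩ := exists_abs_swapRingDeficit_le (L := L) z
  exact sector_integral_eq_trChartMeasure hu z (g := fun t => t * Real.exp (-(b * t)))
    (measurable_id.mul (Real.measurable_exp.comp ((measurable_id.const_mul b).neg))) (M := B) fun P => by
      rw [abs_mul, abs_of_pos (Real.exp_pos _)]
      have h1 : Real.exp (-(b * swapRingDeficit L z P)) ≤ 1 :=
        Real.exp_le_one_iff.2 (by have := swapRingDeficit_nonneg (L := L) z P; nlinarith)
      calc |swapRingDeficit L z P| * Real.exp (-(b * swapRingDeficit L z P)) ≤ B * 1 :=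
          mul_le_mul (hB P) h1 (Real.exp_pos _).le ((abs_nonneg _).trans (hB P))
        _ = B := mul_one B

/-! ## §3 `(TS)_z` at fixed `L` from per-sign-pattern stiffness in the translated chart -/

set_option maxHeartbeats 400000 in
/-- ★★★ **`(TS)_z` AT FIXED `L`, `b > 0`, FROM TRANSLATED-CHART STIFFNESS PER SIGN PATTERN**: let `Good` be any class of sign patterns.  If for every
`ε ∈ Good` the chart-measure stiffness `κ·∫e^{−bF̂ᵘ_ε}d(chartMeasure) ≤ b·∫F̂ᵘ_ε e^{−bF̂ᵘ_ε}d(chartMeasure)` holds, and for every `ε ∉ Good` the pointwise floor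
`κ ≤ b·F̂ᵘ_{a,ε}(η)` holds at every hub with `a.re ≠ 0`, `a.im ≠ 0` (a `chartMeasure`-conull set of hubs, ✓`ae_hub_re_im_ne_zero_chartMeasure`), then
`κ·∫e^{−bF^S_z}dμ_L ≤ b·∫F^S_z e^{−bF^S_z}dμ_L`. [cite: Luscher1983, §2] -/
theorem sectorStiffness_of_trChartStiffness {u : ℍ} (hu : ‖u‖ = 1) (z : Fin 3 → Bool) (Good : GnoSign L → Prop) {κ b : ℝ} (hb : 0 < b)
    (hgood : ∀ ε : GnoSign L, Good ε →
      κ * ∫ x, Real.exp (-(b * trGnoDeficit u z (fun _ => 1) x.1 ε x.2)) ∂chartMeasure L ≤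
        b * ∫ x, trGnoDeficit u z (fun _ => 1) x.1 ε x.2 * Real.exp (-(b * trGnoDeficit u z (fun _ => 1) x.1 ε x.2)) ∂chartMeasure L)
    (hbad : ∀ a : ℍ, a.re ≠ 0 → a.im ≠ 0 → ∀ ε : GnoSign L, ¬ Good ε → ∀ η : GnoCoord L, κ ≤ b * trGnoDeficit u z (fun _ => 1) a ε η) :
    κ * ∫ P, Real.exp (-(b * swapRingDeficit L z P)) ∂(ringMeasure L) ≤
      b * ∫ P, swapRingDeficit L z P * Real.exp (-(b * swapRingDeficit L z P)) ∂(ringMeasure L) := by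
  haveI := isFiniteMeasure_chartMeasure (L := L)
  rw [sector_exp_eq_trChartMeasure hu z hb.le, sector_action_eq_trChartMeasure hu z hb.le]
  -- per sign pattern: `κ·Z_ε ≤ b·E_ε` on the chart measure
  have hper : ∀ ε : GnoSign L, κ * ∫ x, Real.exp (-(b * trGnoDeficit u z (fun _ => 1) x.1 ε x.2)) ∂chartMeasure L ≤
      b * ∫ x, trGnoDeficit u z (fun _ => 1) x.1 ε x.2 * Real.exp (-(b * trGnoDeficit u z (fun _ => 1) x.1 ε x.2)) ∂chartMeasure L := by
    intro ε
    by_cases hε : Good ε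
    · exact hgood ε hε
    · -- bad pattern: pointwise at chart-a.e. point (`a.re ≠ 0`, `a.im ≠ 0`)
      have hF : Measurable fun x : ℍ × GnoCoord L => trGnoDeficit u z (fun _ => 1) x.1 ε x.2 := measurable_trGnoDeficit_uncurry u z (fun _ => 1) ε
      obtain ⟨B, hB0, hB⟩ := exists_abs_trGnoDeficit_le (L := L) u z (fun _ => 1)
      have hnn : ∀ x : ℍ × GnoCoord L, 0 ≤ trGnoDeficit u z (fun _ => (1 : SU2)) x.1 ε x.2 := fun x => trGnoDeficit_nonneg u z _ x.1 ε x.2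
      have hZi : Integrable (fun x : ℍ × GnoCoord L => Real.exp (-(b * trGnoDeficit u z (fun _ => 1) x.1 ε x.2))) (chartMeasure L) :=
        integrable_chartMeasure_of_bounded ((hF.const_mul b).neg.exp) (M := 1) fun x => by
          rw [abs_of_pos (Real.exp_pos _)]
          exact Real.exp_le_one_iff.2 (by have := hnn x; nlinarith)
      have hEi : Integrable (fun x : ℍ × GnoCoord L => trGnoDeficit u z (fun _ => 1) x.1 ε x.2 * Real.exp (-(b * trGnoDeficit u z (fun _ => 1) x.1 ε x.2)))
          (chartMeasure L) :=
        integrable_chartMeasure_of_bounded (hF.mul (hF.const_mul b).neg.exp) (M := B) fun x => by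
          rw [abs_mul, abs_of_pos (Real.exp_pos _)]
          have h1 : Real.exp (-(b * trGnoDeficit u z (fun _ => 1) x.1 ε x.2)) ≤ 1 := Real.exp_le_one_iff.2 (by have := hnn x; nlinarith)
          calc |trGnoDeficit u z (fun _ => 1) x.1 ε x.2| * Real.exp (-(b * trGnoDeficit u z (fun _ => 1) x.1 ε x.2)) ≤ B * 1 :=
              mul_le_mul (hB x.1 ε x.2) h1 (Real.exp_pos _).le hB0
            _ = B := mul_one B
      rw [← integral_const_mul, ← integral_const_mul]
      refine integral_mono_ae (hZi.const_mul κ) (hEi.const_mul b) ?_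
      refine (ae_hub_re_im_ne_zero_chartMeasure (L := L)).mono fun x hx => ?_
      have hpt := hbad x.1 hx.1 hx.2 ε hε x.2
      have he : 0 ≤ Real.exp (-(b * trGnoDeficit u z (fun _ => 1) x.1 ε x.2)) := (Real.exp_pos _).le
      calc κ * Real.exp (-(b * trGnoDeficit u z (fun _ => 1) x.1 ε x.2))
          ≤ (b * trGnoDeficit u z (fun _ => 1) x.1 ε x.2) * Real.exp (-(b * trGnoDeficit u z (fun _ => 1) x.1 ε x.2)) := mul_le_mul_of_nonneg_right hpt he
        _ = b * (trGnoDeficit u z (fun _ => 1) x.1 ε x.2 * Real.exp (-(b * trGnoDeficit u z (fun _ => 1) x.1 ε x.2))) := by ring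
  -- sum over the sign patterns and multiply by `K_L ≥ 0`
  have hKL : 0 ≤ KL L := KL_nonneg
  have hsum := Finset.sum_le_sum fun ε (_ : ε ∈ (Finset.univ : Finset (GnoSign L))) => hper ε
  rw [← Finset.mul_sum, ← Finset.mul_sum] at hsum
  calc κ * (KL L * ∑ ε : GnoSign L, ∫ x, Real.exp (-(b * trGnoDeficit u z (fun _ => 1) x.1 ε x.2)) ∂chartMeasure L)
      = KL L * (κ * ∑ ε : GnoSign L, ∫ x, Real.exp (-(b * trGnoDeficit u z (fun _ => 1) x.1 ε x.2)) ∂chartMeasure L) := by ring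
    _ ≤ KL L * (b * ∑ ε : GnoSign L, ∫ x, trGnoDeficit u z (fun _ => 1) x.1 ε x.2 * Real.exp (-(b * trGnoDeficit u z (fun _ => 1) x.1 ε x.2)) ∂chartMeasure L) :=
        mul_le_mul_of_nonneg_left hsum hKL
    _ = b * (KL L * ∑ ε : GnoSign L, ∫ x, trGnoDeficit u z (fun _ => 1) x.1 ε x.2 * Real.exp (-(b * trGnoDeficit u z (fun _ => 1) x.1 ε x.2)) ∂chartMeasure L) := by
        ring

/-! ## §4 The uniform `(TS)_001` socket: the skeleton's `stub_h001_window` from two translated-chart stubs -/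

/-- ★★ **`stub_h001_window` FROM THE TWO TRANSLATED-CHART STUBS** (any fixed unit `u`, e.g. `u = qJ`; any classes `Good L` of sign patterns): if above a
polynomial threshold `K₁·L^{q₁} ≤ b` every good pattern is stiff in the translated chart measure with `κ_L = 9L⁴ − 3/2 + 1/8`, and above a polynomial threshold
`K₂·L^{q₂} ≤ b` every bad pattern has the pointwise floor `κ_L ≤ b·F̂ᵘ_{z₁,a,ε}(η)` at every hub with `a.re ≠ 0`, `a.im ≠ 0`, then LITERALLY the statement of the
skeleton stub `stub_h001_window` holds (the `h1` input of ✓`twoSectorStiffness_of_windows`). [cite: Luscher1983, §2] -/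
theorem h001_of_trChart_stubs {u : ℍ} (hu : ‖u‖ = 1) (Good : ∀ L : ℕ, GnoSign L → Prop)
    (hgood : ∃ K : ℝ, 0 < K ∧ ∃ q : ℕ, ∀ (L : ℕ) [NeZero L] (b : ℝ), K * (L : ℝ) ^ q ≤ b → ∀ ε : GnoSign L, Good L ε →
      (9 * (L : ℝ) ^ 4 - 3 / 2 + 1 / 8) * ∫ x, Real.exp (-(b * trGnoDeficit u z₁ (fun _ => 1) x.1 ε x.2)) ∂chartMeasure L ≤
        b * ∫ x, trGnoDeficit u z₁ (fun _ => 1) x.1 ε x.2 * Real.exp (-(b * trGnoDeficit u z₁ (fun _ => 1) x.1 ε x.2)) ∂chartMeasure L)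
    (hbad : ∃ K : ℝ, 0 < K ∧ ∃ q : ℕ, ∀ (L : ℕ) [NeZero L] (b : ℝ), K * (L : ℝ) ^ q ≤ b →
      ∀ a : ℍ, a.re ≠ 0 → a.im ≠ 0 → ∀ ε : GnoSign L, ¬ Good L ε → ∀ η : GnoCoord L,
        9 * (L : ℝ) ^ 4 - 3 / 2 + 1 / 8 ≤ b * trGnoDeficit u z₁ (fun _ => 1) a ε η) :
    ∃ K : ℝ, 0 < K ∧ ∃ q : ℕ, ∀ (L : ℕ) [NeZero L] (b : ℝ), K * (L : ℝ) ^ q ≤ b →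
      (9 * (L : ℝ) ^ 4 - 3 / 2 + 1 / 8) * ∫ P, Real.exp (-(b * swapRingDeficit L z₁ P)) ∂(ringMeasure L) ≤
        b * ∫ P, swapRingDeficit L z₁ P * Real.exp (-(b * swapRingDeficit L z₁ P)) ∂(ringMeasure L) := by
  obtain ⟨K₁, hK₁, q₁, h₁⟩ := hgood
  obtain ⟨K₂, hK₂, q₂, h₂⟩ := hbad
  refine ⟨K₁ + K₂ + 1, by positivity, max q₁ q₂, fun L _ b hb => ?_⟩
  have hL1 : (1 : ℝ) ≤ L := by exact_mod_cast NeZero.one_le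
  have hLq : (1 : ℝ) ≤ (L : ℝ) ^ max q₁ q₂ := one_le_pow₀ hL1
  have hq₁ : (L : ℝ) ^ q₁ ≤ (L : ℝ) ^ max q₁ q₂ := pow_le_pow_right₀ hL1 (le_max_left _ _)
  have hq₂ : (L : ℝ) ^ q₂ ≤ (L : ℝ) ^ max q₁ q₂ := pow_le_pow_right₀ hL1 (le_max_right _ _)
  have hb₁ : K₁ * (L : ℝ) ^ q₁ ≤ b := by nlinarith [mul_le_mul_of_nonneg_left hq₁ hK₁.le]
  have hb₂ : K₂ * (L : ℝ) ^ q₂ ≤ b := by nlinarith [mul_le_mul_of_nonneg_left hq₂ hK₂.le]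
  have hb0 : 0 < b := by nlinarith
  exact sectorStiffness_of_trChartStiffness hu z₁ (Good L) hb0 (fun ε hε => h₁ L b hb₁ ε hε) (fun a ha1 ha2 ε hε η => h₂ L b hb₂ a ha1 ha2 ε hε η)

/-! ## §5 The same with an arbitrary central seam character (the sector-`z` chart uses `χ_z = sectorChar z`) -/

set_option maxHeartbeats 400000 in
/-- ★★ **THE RING INTEGRAL IN THE TRANSLATED CHART MEASURE, CENTRAL CHARACTER `χ`**: for a unit `u`, a sector `z`, a central `χ` and measurable `g` bounded along
the deficit, `∫ g(F^S_z(P)) dμ_L(P) = K_L·Σ_ε ∫ g(F̂ᵘ_{z,χ,a,ε}(η)) d(chartMeasure)(a,η)`, `F̂ᵘ_{z,χ} = trGnoDeficit u z χ` (✓`integral_ringMeasure_eq_trGnomonic`). [cite: tHooft1979] -/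
theorem sector_integral_eq_trChartMeasure_chi {u : ℍ} (hu : ‖u‖ = 1) (z : Fin 3 → Bool) {χ : Site 3 L → SU2}
    (hχ : ∀ (x : Site 3 L) (k : SU2), k * χ x = χ x * k) {g : ℝ → ℝ} (hg : Measurable g) {M : ℝ}
    (hbd : ∀ P : (Fin (2 * L - 1 + 1) → GaugeConfig 3 L SU2) × (Site 3 L → SU2), |g (swapRingDeficit L z P)| ≤ M) :
    ∫ P, g (swapRingDeficit L z P) ∂(ringMeasure L) =
      KL L * ∑ ε : GnoSign L, ∫ x, g (trGnoDeficit u z χ x.1 ε x.2) ∂chartMeasure L := by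
  have h := integral_ringMeasure_eq_trGnomonic (L := L) hu (⇑(sitePerm (L := L) (Equiv.swap (0 : Fin 3) 1))) (χ := χ) hχ
    (G := fun p => g (swapRingDeficit L z p)) (hg.comp (measurable_swapRingDeficit z)) (M := M) (fun p => hbd p)
    (fun h p => by simp only [swapRingDeficit_seamGaugeAct])
  rw [h]
  show KL L * ∫ a, (∑ ε : GnoSign L, ∫ η : GnoCoord L, g (trGnoDeficit u z χ a ε η) * gnoDensity η) ∂coneMeasure = _
  have hbd' : ∀ (ε : GnoSign L) (x : ℍ × GnoCoord L), |g (trGnoDeficit u z χ x.1 ε x.2)| ≤ M := fun ε x => hbd _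
  have hmeas : ∀ ε : GnoSign L, Measurable fun x : ℍ × GnoCoord L => g (trGnoDeficit u z χ x.1 ε x.2) :=
    fun ε => hg.comp (measurable_trGnoDeficit_uncurry u z χ ε)
  have hint : ∀ ε : GnoSign L, Integrable (fun a : ℍ => ∫ η : GnoCoord L, g (trGnoDeficit u z χ a ε η) * gnoDensity η) coneMeasure :=
    fun ε => integrable_fibreIntegral_of_bounded (hmeas ε) (hbd' ε)
  rw [integral_finsetSum _ fun ε _ => hint ε]
  refine congrArg (fun t => KL L * t) (Finset.sum_congr rfl fun ε _ => ?_)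
  exact (integral_chartMeasure (integrable_chartMeasure_of_bounded (hmeas ε) (hbd' ε))).symm

/-- ★ `Z_z(b) = K_L·Σ_ε ∫ e^{−bF̂ᵘ_{z,χ,ε}} d(chartMeasure)` (`b ≥ 0`, central `χ`). [cite: tHooft1979] -/
theorem sector_exp_eq_trChartMeasure_chi {u : ℍ} (hu : ‖u‖ = 1) (z : Fin 3 → Bool) {χ : Site 3 L → SU2}
    (hχ : ∀ (x : Site 3 L) (k : SU2), k * χ x = χ x * k) {b : ℝ} (hb : 0 ≤ b) :
    ∫ P, Real.exp (-(b * swapRingDeficit L z P)) ∂(ringMeasure L) =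
      KL L * ∑ ε : GnoSign L, ∫ x, Real.exp (-(b * trGnoDeficit u z χ x.1 ε x.2)) ∂chartMeasure L :=
  sector_integral_eq_trChartMeasure_chi hu z hχ (g := fun t => Real.exp (-(b * t))) (Real.measurable_exp.comp ((measurable_id.const_mul b).neg)) (M := 1)
    fun P => by
      rw [abs_of_pos (Real.exp_pos _)]
      exact Real.exp_le_one_iff.2 (by have := swapRingDeficit_nonneg (L := L) z P; nlinarith)

/-- ★ `E_z(b) = K_L·Σ_ε ∫ F̂ᵘ_{z,χ,ε} e^{−bF̂ᵘ_{z,χ,ε}} d(chartMeasure)` (`b ≥ 0`, central `χ`). [cite: tHooft1979] -/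
theorem sector_action_eq_trChartMeasure_chi {u : ℍ} (hu : ‖u‖ = 1) (z : Fin 3 → Bool) {χ : Site 3 L → SU2}
    (hχ : ∀ (x : Site 3 L) (k : SU2), k * χ x = χ x * k) {b : ℝ} (hb : 0 ≤ b) :
    ∫ P, swapRingDeficit L z P * Real.exp (-(b * swapRingDeficit L z P)) ∂(ringMeasure L) =
      KL L * ∑ ε : GnoSign L, ∫ x, trGnoDeficit u z χ x.1 ε x.2 * Real.exp (-(b * trGnoDeficit u z χ x.1 ε x.2)) ∂chartMeasure L := by
  obtain ⟨B, hB⟩ := exists_abs_swapRingDeficit_le (L := L) z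
  exact sector_integral_eq_trChartMeasure_chi hu z hχ (g := fun t => t * Real.exp (-(b * t)))
    (measurable_id.mul (Real.measurable_exp.comp ((measurable_id.const_mul b).neg))) (M := B) fun P => by
      rw [abs_mul, abs_of_pos (Real.exp_pos _)]
      have h1 : Real.exp (-(b * swapRingDeficit L z P)) ≤ 1 :=
        Real.exp_le_one_iff.2 (by have := swapRingDeficit_nonneg (L := L) z P; nlinarith)
      calc |swapRingDeficit L z P| * Real.exp (-(b * swapRingDeficit L z P)) ≤ B * 1 :=
          mul_le_mul (hB P) h1 (Real.exp_pos _).le ((abs_nonneg _).trans (hB P))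
        _ = B := mul_one B

set_option maxHeartbeats 400000 in
/-- ★★★ **`(TS)_z` AT FIXED `L`, `b > 0`, FROM TRANSLATED-CHART STIFFNESS PER SIGN PATTERN, CENTRAL CHARACTER `χ`** (the form the sector-`z` chart
`χ = sectorChar z` needs): good patterns stiff in the chart measure, bad patterns with the pointwise floor at hubs `a.re ≠ 0`, `a.im ≠ 0` ⟹ `κ·Z_z(b) ≤ b·E_z(b)`.
[cite: Luscher1983, §2] -/
theorem sectorStiffness_of_trChartStiffness_chi {u : ℍ} (hu : ‖u‖ = 1) (z : Fin 3 → Bool) {χ : Site 3 L → SU2}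
    (hχ : ∀ (x : Site 3 L) (k : SU2), k * χ x = χ x * k) (Good : GnoSign L → Prop) {κ b : ℝ} (hb : 0 < b)
    (hgood : ∀ ε : GnoSign L, Good ε →
      κ * ∫ x, Real.exp (-(b * trGnoDeficit u z χ x.1 ε x.2)) ∂chartMeasure L ≤
        b * ∫ x, trGnoDeficit u z χ x.1 ε x.2 * Real.exp (-(b * trGnoDeficit u z χ x.1 ε x.2)) ∂chartMeasure L)
    (hbad : ∀ a : ℍ, a.re ≠ 0 → a.im ≠ 0 → ∀ ε : GnoSign L, ¬ Good ε → ∀ η : GnoCoord L, κ ≤ b * trGnoDeficit u z χ a ε η) :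
    κ * ∫ P, Real.exp (-(b * swapRingDeficit L z P)) ∂(ringMeasure L) ≤
      b * ∫ P, swapRingDeficit L z P * Real.exp (-(b * swapRingDeficit L z P)) ∂(ringMeasure L) := by
  haveI := isFiniteMeasure_chartMeasure (L := L)
  rw [sector_exp_eq_trChartMeasure_chi hu z hχ hb.le, sector_action_eq_trChartMeasure_chi hu z hχ hb.le]
  have hper : ∀ ε : GnoSign L, κ * ∫ x, Real.exp (-(b * trGnoDeficit u z χ x.1 ε x.2)) ∂chartMeasure L ≤
      b * ∫ x, trGnoDeficit u z χ x.1 ε x.2 * Real.exp (-(b * trGnoDeficit u z χ x.1 ε x.2)) ∂chartMeasure L := by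
    intro ε
    by_cases hε : Good ε
    · exact hgood ε hε
    · have hF : Measurable fun x : ℍ × GnoCoord L => trGnoDeficit u z χ x.1 ε x.2 := measurable_trGnoDeficit_uncurry u z χ ε
      obtain ⟨B, hB0, hB⟩ := exists_abs_trGnoDeficit_le (L := L) u z χ
      have hnn : ∀ x : ℍ × GnoCoord L, 0 ≤ trGnoDeficit u z χ x.1 ε x.2 := fun x => trGnoDeficit_nonneg u z _ x.1 ε x.2
      have hZi : Integrable (fun x : ℍ × GnoCoord L => Real.exp (-(b * trGnoDeficit u z χ x.1 ε x.2))) (chartMeasure L) :=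
        integrable_chartMeasure_of_bounded ((hF.const_mul b).neg.exp) (M := 1) fun x => by
          rw [abs_of_pos (Real.exp_pos _)]
          exact Real.exp_le_one_iff.2 (by have := hnn x; nlinarith)
      have hEi : Integrable (fun x : ℍ × GnoCoord L => trGnoDeficit u z χ x.1 ε x.2 * Real.exp (-(b * trGnoDeficit u z χ x.1 ε x.2)))
          (chartMeasure L) :=
        integrable_chartMeasure_of_bounded (hF.mul (hF.const_mul b).neg.exp) (M := B) fun x => by
          rw [abs_mul, abs_of_pos (Real.exp_pos _)]
          have h1 : Real.exp (-(b * trGnoDeficit u z χ x.1 ε x.2)) ≤ 1 := Real.exp_le_one_iff.2 (by have := hnn x; nlinarith)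
          calc |trGnoDeficit u z χ x.1 ε x.2| * Real.exp (-(b * trGnoDeficit u z χ x.1 ε x.2)) ≤ B * 1 :=
              mul_le_mul (hB x.1 ε x.2) h1 (Real.exp_pos _).le hB0
            _ = B := mul_one B
      rw [← integral_const_mul, ← integral_const_mul]
      refine integral_mono_ae (hZi.const_mul κ) (hEi.const_mul b) ?_
      refine (ae_hub_re_im_ne_zero_chartMeasure (L := L)).mono fun x hx => ?_
      have hpt := hbad x.1 hx.1 hx.2 ε hε x.2
      have he : 0 ≤ Real.exp (-(b * trGnoDeficit u z χ x.1 ε x.2)) := (Real.exp_pos _).le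
      calc κ * Real.exp (-(b * trGnoDeficit u z χ x.1 ε x.2))
          ≤ (b * trGnoDeficit u z χ x.1 ε x.2) * Real.exp (-(b * trGnoDeficit u z χ x.1 ε x.2)) := mul_le_mul_of_nonneg_right hpt he
        _ = b * (trGnoDeficit u z χ x.1 ε x.2 * Real.exp (-(b * trGnoDeficit u z χ x.1 ε x.2))) := by ring
  have hKL : 0 ≤ KL L := KL_nonneg
  have hsum := Finset.sum_le_sum fun ε (_ : ε ∈ (Finset.univ : Finset (GnoSign L))) => hper ε
  rw [← Finset.mul_sum, ← Finset.mul_sum] at hsum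
  calc κ * (KL L * ∑ ε : GnoSign L, ∫ x, Real.exp (-(b * trGnoDeficit u z χ x.1 ε x.2)) ∂chartMeasure L)
      = KL L * (κ * ∑ ε : GnoSign L, ∫ x, Real.exp (-(b * trGnoDeficit u z χ x.1 ε x.2)) ∂chartMeasure L) := by ring
    _ ≤ KL L * (b * ∑ ε : GnoSign L, ∫ x, trGnoDeficit u z χ x.1 ε x.2 * Real.exp (-(b * trGnoDeficit u z χ x.1 ε x.2)) ∂chartMeasure L) :=
        mul_le_mul_of_nonneg_left hsum hKL
    _ = b * (KL L * ∑ ε : GnoSign L, ∫ x, trGnoDeficit u z χ x.1 ε x.2 * Real.exp (-(b * trGnoDeficit u z χ x.1 ε x.2)) ∂chartMeasure L) := by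
        ring

/-- ★★ **`stub_h001_window` FROM THE TWO TRANSLATED-CHART STUBS WITH A CENTRAL CHARACTER `χ_L`** (the skeleton takes `χ_L = sectorChar z₁`, `u = uJ`,
`Good = GoodSign`): the uniform form of `sectorStiffness_of_trChartStiffness_chi`, output LITERALLY the skeleton stub `stub_h001_window`. [cite: Luscher1983, §2] -/
theorem h001_of_trChart_stubs_chi {u : ℍ} (hu : ‖u‖ = 1) (χ : ∀ L : ℕ, Site 3 L → SU2)
    (hχ : ∀ (L : ℕ) (x : Site 3 L) (k : SU2), k * χ L x = χ L x * k) (Good : ∀ L : ℕ, GnoSign L → Prop)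
    (hgood : ∃ K : ℝ, 0 < K ∧ ∃ q : ℕ, ∀ (L : ℕ) [NeZero L] (b : ℝ), K * (L : ℝ) ^ q ≤ b → ∀ ε : GnoSign L, Good L ε →
      (9 * (L : ℝ) ^ 4 - 3 / 2 + 1 / 8) * ∫ x, Real.exp (-(b * trGnoDeficit u z₁ (χ L) x.1 ε x.2)) ∂chartMeasure L ≤
        b * ∫ x, trGnoDeficit u z₁ (χ L) x.1 ε x.2 * Real.exp (-(b * trGnoDeficit u z₁ (χ L) x.1 ε x.2)) ∂chartMeasure L)
    (hbad : ∃ K : ℝ, 0 < K ∧ ∃ q : ℕ, ∀ (L : ℕ) [NeZero L] (b : ℝ), K * (L : ℝ) ^ q ≤ b →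
      ∀ a : ℍ, a.re ≠ 0 → a.im ≠ 0 → ∀ ε : GnoSign L, ¬ Good L ε → ∀ η : GnoCoord L,
        9 * (L : ℝ) ^ 4 - 3 / 2 + 1 / 8 ≤ b * trGnoDeficit u z₁ (χ L) a ε η) :
    ∃ K : ℝ, 0 < K ∧ ∃ q : ℕ, ∀ (L : ℕ) [NeZero L] (b : ℝ), K * (L : ℝ) ^ q ≤ b →
      (9 * (L : ℝ) ^ 4 - 3 / 2 + 1 / 8) * ∫ P, Real.exp (-(b * swapRingDeficit L z₁ P)) ∂(ringMeasure L) ≤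
        b * ∫ P, swapRingDeficit L z₁ P * Real.exp (-(b * swapRingDeficit L z₁ P)) ∂(ringMeasure L) := by
  obtain ⟨K₁, hK₁, q₁, h₁⟩ := hgood
  obtain ⟨K₂, hK₂, q₂, h₂⟩ := hbad
  refine ⟨K₁ + K₂ + 1, by positivity, max q₁ q₂, fun L _ b hb => ?_⟩
  have hL1 : (1 : ℝ) ≤ L := by exact_mod_cast NeZero.one_le
  have hLq : (1 : ℝ) ≤ (L : ℝ) ^ max q₁ q₂ := one_le_pow₀ hL1
  have hq₁ : (L : ℝ) ^ q₁ ≤ (L : ℝ) ^ max q₁ q₂ := pow_le_pow_right₀ hL1 (le_max_left _ _)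
  have hq₂ : (L : ℝ) ^ q₂ ≤ (L : ℝ) ^ max q₁ q₂ := pow_le_pow_right₀ hL1 (le_max_right _ _)
  have hb₁ : K₁ * (L : ℝ) ^ q₁ ≤ b := by nlinarith [mul_le_mul_of_nonneg_left hq₁ hK₁.le]
  have hb₂ : K₂ * (L : ℝ) ^ q₂ ≤ b := by nlinarith [mul_le_mul_of_nonneg_left hq₂ hK₂.le]
  have hb0 : 0 < b := by nlinarith
  exact sectorStiffness_of_trChartStiffness_chi hu z₁ (hχ L) (Good L) hb0 (fun ε hε => h₁ L b hb₁ ε hε)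
    (fun a ha1 ha2 ε hε η => h₂ L b hb₂ a ha1 ha2 ε hε η)

end Summit.QuantumFields.YangMills.Theorems.SwapVirialDeficit.SectorLaplace

end
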